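import Literature.Topology.FourManifolds.BandSumConcordanceNormalRegular
import Literature.Topology.FourManifolds.BandSumConcordanceProofs
import Literature.Topology.FourManifolds.ConnectedSumNormalFormProofs
import HarnessLib

/-!
# Concordance of connected sums: the Fox–Milnor congruence for regular presentations, and the
# exact upstream of the corner-free congruence

Topic `Literature/Topology/FourManifolds`; sibling of `BandSumConcordanceProofs.lean` and
`BandSumConcordanceNormalRegular.lean` in the proof programme of the named fact
`Literature.Topology.FourManifolds.Knot.IsConnectedSum.isConcordant` (`BandSum.lean`: concordance
is a congruence for the connected sum `#` of oriented knots — Fox–Milnor (1966), §1; Livingston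
(2005), Thm. 2.2: *"The set of concordance classes of knots forms a countable abelian group … with
its operation induced by connected sum"*). **Everything in this file is proved; no definition and
no named fact is introduced.**

The printed theorem concerns knot types, on which `#` is the classical product along an embedded
closed rectangle (Cromwell (2004), §4.6, PDF p. 69 of the held copy: "Choose a rectangular disc
`R` … `L₁ ∩ R = a` and `L₂ ∩ R = c`"), i.e. the tree's **regular** presentations
`Knot.IsRegularConnectedSum` (`SchubertRegular.lean`); the tree's fact quantifies over the wider
class of *corner-free* presentations `Knot.IsConnectedSum` (`BandSum.lean`: the band is controlled
on the open collar only). This file records both readings with their exact upstream sets, the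
corner-free one being the printed one plus one further named fact:

* `Knot.IsRegularNormalConnectedSum.isRegularConnectedSum` — a regular normal presentation is a
  regular connected-sum presentation (splitting sphere the standard equator; verbatim
  `IsNormalConnectedSum.isConnectedSum` with regularity kept).
* `Knot.IsRegularConnectedSum.isConcordant_of_unique` — **the printed Fox–Milnor congruence from
  uniqueness of the regular connected sum up to concordance**: if any two regular connected sums
  of the same two knots are concordant, then regular connected sums of concordant factors are
  concordant (chain the regular one-sided carrying constructions
  `exists_isRegularNormalConnectedSum_isConcordant_left/right` of
  `BandSumConcordanceNormalRegular.lean`, all proved, through the hypothesis at the three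
  junctions `K ≃ K₁ # K₂`, `K₁' # K₂ ≃ K₁' # K₂`, `K₁' # K₂' ≃ K'`); and
  `Knot.IsRegularConnectedSum.isConcordant_iff_unique` — the two are equivalent.
* `Knot.IsRegularConnectedSum.isConcordant_of_isIsotopic` — hence from the printed form of
  Schubert's theorem `IsRegularConnectedSum.isIsotopic` (`SchubertRegular.lean`);
  `…_of_normalPosition_regular` — from the isotopy form of the Schoenflies theorem in `𝕊³` and
  Schubert's theorem in normal position for regular presentations;
  `…_of_ball_of_rebuilt` — from exactly the two named facts still open upstream,
  `SphereEmbedding.schoenflies_exists_ball` (Alexander's theorem, `SchoenfliesSphereThree.lean`) and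
  `Knot.Schubert1949_normalPosition_rebuilt` (the geometric heart, `SchubertNormalForm.lean`), the
  regular band fact being a theorem meanwhile (`BandData.isIsotopic_of_band_eq_of_isRegular_holds`,
  `BandSumIsotopyRegularProofs.lean`).
* `Knot.IsConnectedSum.isConcordant_of_ball_of_exists_ambientIsotopy_of_rebuilt` — the corner-free
  fact itself from the same two named facts **plus** the corner-free band fact
  `BandData.exists_ambientIsotopy_of_band_eq` (`BandSumIsotopy.lean`): by
  `IsConnectedSum.isConcordant_iff_unique` (`BandSumConcordanceProofs.lean`) the fact is uniqueness
  of `#` up to concordance over *arbitrary* corner-free presentations, whose splitting sphere has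
  to be normalised (Alexander) and whose arcs near the four attaching points are not covered by
  the regular band fact.

So the remaining content of `IsConnectedSum.isConcordant` beyond the printed theorem is exactly
the corner-free band fact; no Mathlib or Literature result bears on it (Mathlib has no knots), and
no shortcut through the fourth dimension is known to the sources (a concordance between two
presentations must still identify the positions of non-slice summands, a three-dimensional
matter).

## References

* R. H. Fox, J. W. Milnor, *Singularities of 2-spheres in 4-space and cobordism of knots*, Osaka
  J. Math. 3 (1966), 257–267, §1. [FoxMilnor1966]
* C. Livingston, *A survey of classical knot concordance*, Handbook of Knot Theory (2005), §2.1,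
  Thm. 2.2 (held: arXiv math/0307077, p. 3). [Livingston2005]
* P. R. Cromwell, *Knots and Links* (2004), §4.6 (products along an embedded rectangle; held,
  PDF p. 69). [Cromwell2004]

## Design notes

No statement of another file is modified; the regular congruence is written out as a binder-free
`∀`-statement in each theorem rather than abbreviated by a `def` (D-0026: no new named fact); no
`sorry`; no local notation.
-/

open Set Function

noncomputable section

namespace Literature.Topology.FourManifolds

namespace Knot

/-! ### Regular normal presentations are regular connected sums -/

/-- A regular normal presentation of `K` as `K₁ # K₂` is a regular connected-sum presentation: the
standard equator `SphereEmbedding.standard 2 3` (range `sphereEquator 2`) splits the northern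
summand from the southern one (the last coordinate vanishes somewhere along any path from
`{x₃ > 0}` to `{x₃ < 0}`), and the band crosses it in its middle segment. Verbatim
`IsNormalConnectedSum.isConnectedSum` (`ConnectedSumNormalForm.lean`), keeping the regularity of
the band. Cromwell (2004), §4.6. [folklore] -/
theorem IsRegularNormalConnectedSum.isRegularConnectedSum {K₁ K₂ K : Knot}
    (h : IsRegularNormalConnectedSum K₁ K₂ K) : IsRegularConnectedSum K₁ K₂ K := by
  obtain ⟨A, B, hA, hB, hAN, hBS, b, hcross, hreg⟩ := h
  refine ⟨A, B, hA, hB, SphereEmbedding.standard 2 3 (by norm_num), b, ⟨?_, fun γ ↦ ?_⟩, ?_, hreg⟩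
  · rw [SphereEmbedding.range_standard_eq_sphereEquator, Set.disjoint_left]
    rintro x hx (⟨y, rfl⟩ | ⟨y, rfl⟩)
    · exact (hAN y).ne' ((mem_sphereEquator_iff _).1 hx)
    · exact (hBS y).ne ((mem_sphereEquator_iff _).1 hx)
  · -- intermediate value theorem for `x₃` along `γ`
    let f : unitInterval → ℝ := fun t ↦
      ((γ t : Metric.sphere (0 : EuclideanSpace ℝ (Fin 4)) 1) : EuclideanSpace ℝ (Fin 4)) (Fin.last 3)
    have hf : Continuous f :=
      (PiLp.continuous_apply 2 _ (Fin.last 3)).comp (continuous_subtype_val.comp γ.continuous)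
    have h0 : 0 < f 0 := by simp only [f, Path.source]; exact hAN _
    have h1 : f 1 < 0 := by simp only [f, Path.target]; exact hBS _
    obtain ⟨t, -, ht⟩ : ∃ t ∈ Set.Icc (0 : unitInterval) 1, f t = 0 :=
      intermediate_value_Icc' bot_le hf.continuousOn ⟨h1.le, h0.le⟩
    refine ⟨γ t, ⟨t, rfl⟩, ?_⟩
    rw [SphereEmbedding.range_standard_eq_sphereEquator]
    exact (mem_sphereEquator_iff _).2 ht
  · rw [SphereEmbedding.range_standard_eq_sphereEquator]
    exact hcross

/-! ### The printed congruence from uniqueness of the regular connected sum -/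

/-- **The Fox–Milnor congruence for regular presentations, from uniqueness of the regular
connected sum up to concordance.** If any two regular connected sums of the same two knots are
concordant, then for concordant factors `K₁ ~ K₁'`, `K₂ ~ K₂'` any regular connected sums
`K = K₁ # K₂`, `K' = K₁' # K₂'` are concordant: chain `K ~ L` (hypothesis, `L` the regular normal
witness of the first-factor carrying construction), `L ~ L'` (`K₁ # K₂ ~ K₁' # K₂`,
`exists_isRegularNormalConnectedSum_isConcordant_left`), `L' ~ M` (hypothesis, two witnesses of
`K₁' # K₂`), `M ~ M'` (`K₁' # K₂ ~ K₁' # K₂'`, `exists_isRegularNormalConnectedSum_isConcordant_right`),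
`M' ~ K'` (hypothesis). Fox–Milnor (1966), §1; Livingston (2005), Thm. 2.2; presentations along
embedded rectangles as in Cromwell (2004), §4.6. [cite: FoxMilnor1966, §1] -/
theorem IsRegularConnectedSum.isConcordant_of_unique
    (huniq : ∀ {K₁ K₂ K K' : Knot}, IsRegularConnectedSum K₁ K₂ K → IsRegularConnectedSum K₁ K₂ K' →
      K.IsConcordant K')
    {K₁ K₂ K₁' K₂' K K' : Knot} (hK : IsRegularConnectedSum K₁ K₂ K)
    (hK' : IsRegularConnectedSum K₁' K₂' K') (h₁ : K₁.IsConcordant K₁') (h₂ : K₂.IsConcordant K₂') :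
    K.IsConcordant K' := by
  obtain ⟨L, L', hL, hL', hcL⟩ := exists_isRegularNormalConnectedSum_isConcordant_left K₂ h₁
  obtain ⟨M, M', hM, hM', hcM⟩ := exists_isRegularNormalConnectedSum_isConcordant_right K₁' h₂
  have hE := equivalence_isConcordant_holds
  exact hE.trans (huniq hK hL.isRegularConnectedSum)
    (hE.trans hcL (hE.trans (huniq hL'.isRegularConnectedSum hM.isRegularConnectedSum)
      (hE.trans hcM (huniq hM'.isRegularConnectedSum hK'))))

/-- **The printed Fox–Milnor congruence is equivalent to uniqueness of the regular connected sum
up to concordance** (its diagonal `K₁ = K₁'`, `K₂ = K₂'`, by reflexivity of concordance); the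
regular analogue of `IsConnectedSum.isConcordant_iff_unique` (`BandSumConcordanceProofs.lean`).
Fox–Milnor (1966), §1; Livingston (2005), Thm. 2.2. [cite: FoxMilnor1966, §1] -/
theorem IsRegularConnectedSum.isConcordant_iff_unique :
    (∀ {K₁ K₂ K₁' K₂' K K' : Knot}, IsRegularConnectedSum K₁ K₂ K → IsRegularConnectedSum K₁' K₂' K' →
        K₁.IsConcordant K₁' → K₂.IsConcordant K₂' → K.IsConcordant K') ↔
      ∀ {K₁ K₂ K K' : Knot}, IsRegularConnectedSum K₁ K₂ K → IsRegularConnectedSum K₁ K₂ K' →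
        K.IsConcordant K' := by
  constructor
  · intro h K₁ K₂ K K' hK hK'
    exact h hK hK' (equivalence_isConcordant_holds.refl K₁) (equivalence_isConcordant_holds.refl K₂)
  · intro huniq K₁ K₂ K₁' K₂' K K' hK hK' h₁ h₂
    exact IsRegularConnectedSum.isConcordant_of_unique huniq hK hK' h₁ h₂

/-- **The printed Fox–Milnor congruence from the printed form of Schubert's theorem**
(`IsRegularConnectedSum.isIsotopic`, `SchubertRegular.lean`: any two regular connected sums of the
same knots are isotopic; isotopic knots are concordant, `IsConcordant.of_isIsotopic_holds`).
Fox–Milnor (1966), §1; Livingston (2005), Thm. 2.2. [cite: FoxMilnor1966, §1] -/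
theorem IsRegularConnectedSum.isConcordant_of_isIsotopic (huniq : IsRegularConnectedSum.isIsotopic)
    {K₁ K₂ K₁' K₂' K K' : Knot} (hK : IsRegularConnectedSum K₁ K₂ K)
    (hK' : IsRegularConnectedSum K₁' K₂' K') (h₁ : K₁.IsConcordant K₁') (h₂ : K₂.IsConcordant K₂') :
    K.IsConcordant K' :=
  IsRegularConnectedSum.isConcordant_of_unique
    (fun hL hL' ↦ IsConcordant.of_isIsotopic_holds (huniq hL hL')) hK hK' h₁ h₂

/-- The printed Fox–Milnor congruence from the isotopy form of the Schoenflies theorem in `𝕊³`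
(`hS`) and Schubert's theorem in normal position for regular presentations (`hH`), through
`IsRegularConnectedSum.isIsotopic_of_normalPosition` (`SchubertRegular.lean`).
[cite: FoxMilnor1966, §1] -/
theorem IsRegularConnectedSum.isConcordant_of_normalPosition_regular
    (hS : SphereEmbedding.schoenflies_exists_ambientIsotopy_image_eq_sphereEquator)
    (hH : Schubert1949_normalPosition_regular)
    {K₁ K₂ K₁' K₂' K K' : Knot} (hK : IsRegularConnectedSum K₁ K₂ K)
    (hK' : IsRegularConnectedSum K₁' K₂' K') (h₁ : K₁.IsConcordant K₁') (h₂ : K₂.IsConcordant K₂') :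
    K.IsConcordant K' :=
  IsRegularConnectedSum.isConcordant_of_isIsotopic
    (IsRegularConnectedSum.isIsotopic_of_normalPosition hS hH) hK hK' h₁ h₂

/-- **The printed Fox–Milnor congruence from the two named facts still open upstream**: the ball
form of the Schoenflies theorem in `𝕊³` (`hB`, Alexander's theorem, `SchoenfliesSphereThree.lean`)
and Schubert's theorem for rebuilt presentations in normal position (`hR`,
`SchubertNormalForm.lean`); the regular band fact is the theorem
`BandData.isIsotopic_of_band_eq_of_isRegular_holds` (`BandSumIsotopyRegularProofs.lean`). Through
`IsRegularConnectedSum.isIsotopic_of_ball_of_regular_band_eq_of_rebuilt` (`SchubertRegular.lean`).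
[cite: FoxMilnor1966, §1] -/
theorem IsRegularConnectedSum.isConcordant_of_ball_of_rebuilt
    (hB : SphereEmbedding.schoenflies_exists_ball) (hR : Schubert1949_normalPosition_rebuilt)
    {K₁ K₂ K₁' K₂' K K' : Knot} (hK : IsRegularConnectedSum K₁ K₂ K)
    (hK' : IsRegularConnectedSum K₁' K₂' K') (h₁ : K₁.IsConcordant K₁') (h₂ : K₂.IsConcordant K₂') :
    K.IsConcordant K' :=
  IsRegularConnectedSum.isConcordant_of_isIsotopic
    (IsRegularConnectedSum.isIsotopic_of_ball_of_regular_band_eq_of_rebuilt hB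
      BandData.isIsotopic_of_band_eq_of_isRegular_holds hR) hK hK' h₁ h₂

/-! ### The corner-free fact: the same two named facts plus the corner-free band fact -/

/-- **The exact upstream of the corner-free congruence.** The named fact
`IsConnectedSum.isConcordant` (arbitrary corner-free presentations on both sides) follows from the
ball form of the Schoenflies theorem in `𝕊³` (`hB`), the corner-free band fact
`BandData.exists_ambientIsotopy_of_band_eq` (`hgeom`, `BandSumIsotopy.lean`) and Schubert's theorem
for rebuilt presentations (`hR`): these give Schubert's uniqueness for corner-free presentations
(`IsConnectedSum.isIsotopic_of_ball_of_exists_ambientIsotopy_of_rebuilt`,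
`ConnectedSumNormalFormProofs.lean`), which suffices by `IsConnectedSum.isConcordant_of_schubert`
(`BandSumConcordanceLeftProofs.lean`). Compared with
`IsRegularConnectedSum.isConcordant_of_ball_of_rebuilt`, the only additional input is the
corner-free band fact. Fox–Milnor (1966), §1; Livingston (2005), Thm. 2.2. [cite: FoxMilnor1966, §1] -/
theorem IsConnectedSum.isConcordant_of_ball_of_exists_ambientIsotopy_of_rebuilt
    (hB : SphereEmbedding.schoenflies_exists_ball) (hgeom : BandData.exists_ambientIsotopy_of_band_eq)
    (hR : Schubert1949_normalPosition_rebuilt) : IsConnectedSum.isConcordant :=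
  IsConnectedSum.isConcordant_of_schubert
    (IsConnectedSum.isIsotopic_of_ball_of_exists_ambientIsotopy_of_rebuilt hB hgeom hR)

/-- The corner-free congruence implies the printed one (regular presentations are corner-free
presentations, `IsRegularConnectedSum.isConnectedSum`). [folklore] -/
theorem IsRegularConnectedSum.isConcordant_of_general (h : IsConnectedSum.isConcordant)
    {K₁ K₂ K₁' K₂' K K' : Knot} (hK : IsRegularConnectedSum K₁ K₂ K)
    (hK' : IsRegularConnectedSum K₁' K₂' K') (h₁ : K₁.IsConcordant K₁') (h₂ : K₂.IsConcordant K₂') :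
    K.IsConcordant K' :=
  h hK.isConnectedSum hK'.isConnectedSum h₁ h₂

end Knot

end Literature.Topology.FourManifolds
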